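import Summits.HodgeConjecture.HodgeConjecture.Theorems.F0P2oHeisenbergYCoinvariantsJacquet   -- ★ p831322: `r_N = S_Y` in the dot model (§3), scalars (§4), chirps (§5)
import Summits.HodgeConjecture.HodgeConjecture.Theorems.F0P2oParabolicLineChartDocking     -- ★ p831536: `exists_linearMap_lineBlock`, the chirp `c` and its three properties
import Summits.HodgeConjecture.HodgeConjecture.Theorems.F0P2oFrameStabiliserYTriviality    -- ★ p831732: the stabiliser of the line by its frame action
import Literature.RepresentationTheory.HeisenbergGroup.SchrodingerSymplecticTransport      -- ★ `exists_intertwiner_implements_conj`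
import Literature.RepresentationTheory.HeisenbergGroup.MpPsiIntertwinerCongr               -- ★ `MpPsi.congr`
import HarnessLib

/-!
# Crux `H413`, programme P2, N3 road (S2)-b part 3a — THE ABSTRACT ASSEMBLER: from a splitting `s : G →* S̃p_ψ(ρ_T)`, a matrix action of `G`
# on the hermitian space with a hyperbolic frame, and the three frame-action properties of `N ≤ G`, the `N`-coinvariants of the Weil
# representation `ω = toRep ∘ s` are the fibre over `0` of the `Y`-adapted model: `r_N(ω) ≃ 𝒮(F^{Fin m})`

Cell hodgecm-mathlib (D-0151), FLOOR 0, crux item H413 = stmt-HodgeConjecture-24833, programme P2; N3 road (`F0/P2/B-p18/g28/N3-ROAD.v1.B-p18g28.md`)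
§2 (S1)–(S3), desk F0P2-plan (g8) 18:45:24Z «(S2)-b TRANSPORT».  Seat A-p12 (g17); assembles ★ p830834 ∕ p831043 ∕ p831322 (model) with ★ p831536 ∕ p831732
(chart side) over ★ `exists_frameChart`, ★ `exists_intertwiner_implements_conj`, ★ `MpPsi.congr`.  THEOREMS ONLY (no `def`, no instance, no notation, no named
fact, no `sorry`); never imports a `Cruxes/…/Lines` module; kernel lane `--supports stmt-HodgeConjecture-24833 --as helper`.  HC_CM is proved only modulo the
printed citations until rung 0 closes; nothing printed is asserted here.

THE STATEMENT (`coinvariantsKer_comp_eq_comap_of_frame`, `exists_coinvariants_equiv_of_frame`).  Data: a non-archimedean local field `F` (`2` invertible),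
`ψ` continuous non-trivial; quadratic coordinates `h : IsQuadraticCoordinates φ Ψq δ d` on a commutative `F`-algebra `S` (`S = F ⊕ F δ`, the tree's
`LocalRing L v` with ★ `isQuadraticCoordinates_local`) with `d` a NON-SQUARE (the place does not split) and an involution `σ` (`σ ∘ φ = φ`, `σ δ = −δ`);
a symmetric `T ∈ GL_n(F)` (the real Gram of the pair, ★ `gram`), the Schrödinger model `ρ_T = schrodingerSB (toLinearMap₂' F T) ψ` on `𝒮(F^n)` (the tree's
★ `localSchrodinger`); a HYPERBOLIC FRAME `(x₀, y₀, b, a)` of `B = hermForm σ (T ⊗ 1)` on `Sⁿ` (★ p831733 builds it from the form congruence of ★ `xThetaGqsCM`);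
a group `G` with a splitting `s : G →* MpPsi ρ_T` (the tree's `FinLocalSplittings.s v` composed with the group maps) and a matrix action `M : G →* GL_n(S)` by
isometries with `hι : (s g).1.1 (reIm x) = reIm (M g · x)` (★ `localToSymplectic_reIm`); a subgroup `N ≤ G` such that (`hN`) every `M n⁻¹` fixes `x₀` and moves
each `bⱼ` inside `bⱼ + S x₀`, (`hgen`) every `n ∈ N` is `(t n t⁻¹ n⁻¹)(n₁ n₂ n₁⁻¹ n₂⁻¹)` with `M t⁻¹` diagonal on `x₀` and the `bⱼ` (★ p831536
`exists_eq_conjQuot_mul_commutator` + ★ p831733 `conj_upper∕diagonal_mulVec_frame`), (`hZ`) for every `t : F` some `n ∈ N` has `M n⁻¹` fixing `x₀, bⱼ` and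
`M n⁻¹ y₀ = y₀ + μ x₀`, `σ μ = φ(t) δ`.  Conclusion: there are `Ψ : 𝒮(F^n) ≃ₗ 𝒮(F^{Fin 2 ⊔ Fin m})` and the fibre-over-`0` map `φ₀` with
**`Coinvariants.ker (ω|_N) = Ψ⁻¹(ker φ₀)`** and **`r_N(ω) = (ω|_N).Coinvariants ≃ₗ[ℂ] 𝒮(F^{Fin m})`**, `ω = toRep ∘ s`.

THE PROOF.  `Γ` = the frame chart (★ `exists_frameChart`), `Γv = Γ ∘ reIm`; `Φ = conjCoboundaryEquiv Γ`, `Ψ` the intertwiner `ρ_T → ρ_dot ∘ Φ`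
(★ `exists_intertwiner_implements_conj`); `s′ = MpPsi.congr ∘ s : G →* MpPsi ρ_dot`, whose symplectic components act by `(s′ g) (Γv v) = Γv (M g · v)`
(`hι` + ★ `symplecticConjOfAlt_apply`).  By ★ p831732 and `hN` every `s′ n` is `Y^⊥`-trivial, hence acts on `S_Y` by a non-zero scalar (★ p831043
`exists_fibreZero_toRep_eq_smul`); every frame-diagonal `s′ t` is `Y`-stable; so conjugation-quotients and commutators act trivially (★ p831322 §4) and by `hgen`
ALL of `N` acts trivially on `S_Y` — (h₁).  By `hZ` + ★ p831732 the centre family acts as `unipotentσ (t • c)` for the norm chirp `c` of ★ p831536, which is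
symmetric, `1` on `X₀` and anisotropic transversally (`d` non-square) — so ★ p831322 §5 gives (h₂) scalar-free.  ★ p831322 §3: `Coinvariants.ker (ω′|_N) = ker φ₀`;
transport back along `Ψ` (`coinvariantsKer_eq_comap_of_intertwiner`).
[MoeglinVignerasWaldspurger1987, Chap. 2 I.7, II.1, Chap. 3 §IV.2, §IV.5; Kudla1986, Thm. 2.8; GelbartRogawski1991, §3.2 (3.2.3) p. 457; BernsteinZelevinsky1976, §2.30–2.33.]

## References
* [MoeglinVignerasWaldspurger1987] C. Mœglin, M.-F. Vignéras, J.-L. Waldspurger, *Correspondances de Howe sur un corps p-adique*, LNM 1291 (1987): Chap. 2 I.7, II.1;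
  Chap. 3 §IV.2 (mixed model), §IV.5 (filtration de Kudla).
* [Kudla1986] S. Kudla, *On the local theta-correspondence*, Invent. Math. 83 (1986): Thm. 2.8 and its proof.
* [GelbartRogawski1991] S. Gelbart, J. Rogawski, Invent. Math. 105 (1991): §3.2 (3.2.1)–(3.2.3) p. 457.
* [BernsteinZelevinsky1976] I. N. Bernstein, A. V. Zelevinsky, Russian Math. Surveys 31 (1976): §2.30–2.33.
-/

set_option autoImplicit false
set_option linter.dupNamespace false -- the mandated namespace repeats the single-problem summit's segment

noncomputable section

open scoped MatrixGroups
open _root_.Matrix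
open Literature.NumberTheory.Automorphic Literature.NumberTheory.Automorphic.UnitaryGroup
open Literature.NumberTheory.Automorphic.UnitaryGroup.QuadraticCoordinates Literature.NumberTheory.Automorphic.UnitaryGroup.IsQuadraticCoordinates
open Literature.RepresentationTheory Literature.RepresentationTheory.HeisenbergGroup
open Summit.HodgeConjecture.HodgeConjecture.Cruxes.H413.F0P2oHeisenbergYCoinvariants
open Summit.HodgeConjecture.HodgeConjecture.Cruxes.H413.F0P2oHeisenbergYCoinvariantsSchur
open Summit.HodgeConjecture.HodgeConjecture.Cruxes.H413.F0P2oHeisenbergYCoinvariantsJacquet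
open Summit.HodgeConjecture.HodgeConjecture.Cruxes.H413.F0P2oParabolicLineChartDocking
open Summit.HodgeConjecture.HodgeConjecture.Cruxes.H413.F0P2oFrameStabiliserYTriviality

namespace Summit.HodgeConjecture.HodgeConjecture.Cruxes.H413.F0P2oYCoinvariantsOfFrameAssembly

/-! ## §1 Coinvariants along an intertwining isomorphism -/

section Transport

variable {k : Type*} [CommRing k] {G : Type*} [Group G] {V₁ V₂ : Type*} [AddCommGroup V₁] [Module k V₁] [AddCommGroup V₂] [Module k V₂]
  (τ₁ : Representation k G V₁) (τ₂ : Representation k G V₂) (Ψ : V₁ ≃ₗ[k] V₂) (hΨ : ∀ (g : G) (v : V₁), Ψ (τ₁ g v) = τ₂ g (Ψ v))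

include hΨ in
/-- **coboundaries transport along an intertwining isomorphism**: `Coinvariants.ker τ₁ = Ψ⁻¹ (Coinvariants.ker τ₂)`. [cite: BernsteinZelevinsky1976, §2.30–2.33] -/
theorem coinvariantsKer_eq_comap_of_intertwiner :
    Representation.Coinvariants.ker τ₁ = (Representation.Coinvariants.ker τ₂).comap (Ψ : V₁ →ₗ[k] V₂) := by
  apply le_antisymm
  · refine Submodule.span_le.2 ?_
    rintro _ ⟨⟨g, v⟩, rfl⟩
    rw [SetLike.mem_coe, Submodule.mem_comap, LinearEquiv.coe_coe, map_sub, hΨ]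
    exact Representation.Coinvariants.sub_mem_ker g (Ψ v)
  · intro v hv
    rw [Submodule.mem_comap, LinearEquiv.coe_coe] at hv
    have hle : Representation.Coinvariants.ker τ₂ ≤ (Representation.Coinvariants.ker τ₁).map (Ψ : V₁ →ₗ[k] V₂) := by
      refine Submodule.span_le.2 ?_
      rintro _ ⟨⟨g, w⟩, rfl⟩
      refine ⟨τ₁ g (Ψ.symm w) - Ψ.symm w, Representation.Coinvariants.sub_mem_ker g _, ?_⟩
      rw [LinearEquiv.coe_coe, map_sub, hΨ, LinearEquiv.apply_symm_apply]
    obtain ⟨u, hu, hu'⟩ := hle hv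
    rw [LinearEquiv.coe_coe] at hu'
    rwa [← Ψ.injective hu']

include hΨ in
/-- **`r(τ₁) ≃ W` from `Coinvariants.ker τ₂ = ker φ₀`, `φ₀` onto `W`**: the coinvariants of `τ₁` are `W` through `φ₀ ∘ Ψ`. [cite: BernsteinZelevinsky1976, §2.30–2.33] -/
theorem exists_coinvariants_equiv_of_intertwiner {W : Type*} [AddCommGroup W] [Module k W] (φ₀ : V₂ →ₗ[k] W) (hφ₀ : Function.Surjective φ₀)
    (hker : Representation.Coinvariants.ker τ₂ = LinearMap.ker φ₀) :
    ∃ e : Representation.Coinvariants τ₁ ≃ₗ[k] W, ∀ v, e (Representation.Coinvariants.mk τ₁ v) = φ₀ (Ψ v) := by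
  have hk : Representation.Coinvariants.ker τ₁ = LinearMap.ker (φ₀ ∘ₗ (Ψ : V₁ →ₗ[k] V₂)) := by
    rw [coinvariantsKer_eq_comap_of_intertwiner τ₁ τ₂ Ψ hΨ, hker, LinearMap.ker_comp]
  refine ⟨(Submodule.quotEquivOfEq _ _ hk).trans (LinearMap.quotKerEquivOfSurjective _ (hφ₀.comp Ψ.surjective)), fun v => rfl⟩

end Transport

/-! ## §2 The frame-action mechanism in the dot model: (h₁) and (h₂) of ★ p831322 from a splitting acting through the chart -/

section Mechanism

variable {F : Type*} [Field F] [ValuativeRel F] [TopologicalSpace F] [IsNonarchimedeanLocalField F] [Invertible (2 : F)]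
  {ψ : AddChar F Circle} (hl : IsLocallyConstant (⇑ψ : F → Circle)) {m : ℕ}
  (hb₂ : ∀ y : (Fin 2 ⊕ Fin m) → F, Continuous fun u : (Fin 2 ⊕ Fin m) → F => dotProductBilin F F u y)
  (hb₀ : ∀ y₀ : Fin m → F, Continuous fun u₀ : Fin m → F => dotProductBilin F F u₀ y₀)
  (φ₀ : SchwartzBruhat ((Fin 2 ⊕ Fin m) → F) →ₗ[ℂ] SchwartzBruhat (Fin m → F))
  (hφ₀ : ∀ (f : SchwartzBruhat ((Fin 2 ⊕ Fin m) → F)) (u₀ : Fin m → F),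
    (φ₀ f : (Fin m → F) → ℂ) u₀ = (f : ((Fin 2 ⊕ Fin m) → F) → ℂ) (Sum.elim 0 u₀))
  {S : Type*} [CommRing S] {φ : F →+* S} {Ψq : (F × F) ≃+ S} {δ : S} {d : F} (hq : IsQuadraticCoordinates φ Ψq δ d)
  {σ : S →+* S} {n : Type*} [Fintype n] [DecidableEq n] {T : Matrix n n F} {x₀ y₀ : n → S} {b : Fin m → n → S} {a : Fin m → F}
  (Γv : (n → S) → ((Fin 2 ⊕ Fin m) → F) × ((Fin 2 ⊕ Fin m) → F))
  (hΓ : ∀ v : n → S, Γv v =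
    (Sum.elim ![re Ψq (hermForm σ (T.map φ) x₀ v), im Ψq (hermForm σ (T.map φ) x₀ v)]
        (fun j => (a j)⁻¹ * re Ψq (hermForm σ (T.map φ) (b j) v)),
      Sum.elim ![im Ψq (hermForm σ (T.map φ) y₀ v), -re Ψq (hermForm σ (T.map φ) y₀ v)]
        (fun j => im Ψq (hermForm σ (T.map φ) (b j) v))))
  (hsurj : ∀ w : ((Fin 2 ⊕ Fin m) → F) × ((Fin 2 ⊕ Fin m) → F), ∃ v : n → S, Γv v = w)
  {G : Type*} [Group G] (s' : G →* MpPsi (schrodingerSB (dotProductBilin F F (m := Fin 2 ⊕ Fin m)) ψ hl hb₂)) (M : G →* GL n S)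
  (hact : ∀ (g : G) (v : n → S), ((s' g).1.1).1 (Γv v) = Γv ((M g : Matrix n n S) *ᵥ v))
  (hadj : ∀ (g : G) (x v : n → S),
    hermForm σ (T.map φ) x ((M g : Matrix n n S) *ᵥ v) = hermForm σ (T.map φ) (((M g⁻¹ : GL n S) : Matrix n n S) *ᵥ x) v)
  (N : Subgroup G)

include hΓ hsurj hact hadj hφ₀ hb₀ in
/-- **(h₁) FROM THE FRAME ACTION**: if the splitting `s′` acts through the chart by isometries `M g` (`hact`, `hadj`), every `M n⁻¹` (`n ∈ N`) fixes `x₀`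
and moves each `bⱼ` inside `bⱼ + S x₀` (`hN`), and every `n ∈ N` is a torus conjugation-quotient times a commutator (`hgen`), then `N` acts TRIVIALLY on
`S_Y` through `φ₀` (★ p831732 + ★ p831043 `exists_fibreZero_toRep_eq_smul` + ★ p831322 §4). [cite: Kudla1986, proof of Thm. 2.8]
[cite: MoeglinVignerasWaldspurger1987, Chap. 3 §IV.2, §IV.5] -/
theorem fibreZero_toRep_eq_of_frameAction (hψ : ψ.IsContinuousNontrivial) (ha : ∀ j, a j ≠ 0)
    (hN : ∀ nn ∈ N, ((M nn⁻¹ : GL n S) : Matrix n n S) *ᵥ x₀ = x₀ ∧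
      ∀ j, ∃ μ : S, ((M nn⁻¹ : GL n S) : Matrix n n S) *ᵥ b j = b j + μ • x₀)
    (hgen : ∀ nn ∈ N, ∃ t : G, (∃ α : S, ((M t⁻¹ : GL n S) : Matrix n n S) *ᵥ x₀ = α • x₀) ∧
      (∀ j, ∃ ν : S, ((M t⁻¹ : GL n S) : Matrix n n S) *ᵥ b j = ν • b j) ∧
      ∃ n₁ ∈ N, ∃ n₂ ∈ N, nn = t * nn * t⁻¹ * nn⁻¹ * (n₁ * n₂ * n₁⁻¹ * n₂⁻¹))
    {nn : G} (hnn : nn ∈ N) (f : SchwartzBruhat ((Fin 2 ⊕ Fin m) → F)) :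
    φ₀ (MpPsi.toRep (schrodingerSB (dotProductBilin F F) ψ hl hb₂) (s' nn) f) = φ₀ f := by
  -- (a) `N` is `Y^⊥`-trivial, so acts on `S_Y` by non-zero scalars
  have hYp : ∀ nn ∈ N, ∀ w : ((Fin 2 ⊕ Fin m) → F) × ((Fin 2 ⊕ Fin m) → F), w.1 ∘ Sum.inl = 0 →
      ∃ y₁ : Fin 2 → F, ((s' nn).1.1).1 w = w + (0, Sum.elim y₁ 0) := by
    intro nn hnn w hw
    obtain ⟨v, rfl⟩ := hsurj w
    rw [hact]
    obtain ⟨hx0, hbμ⟩ := hN nn hnn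
    exact exists_frameCoords_mulVec_eq_add Γv hΓ _ _ (hadj nn) hx0 hbμ v hw
  have hscal : ∀ nn ∈ N, ∃ cst : ℂ, cst ≠ 0 ∧ ∀ f,
      φ₀ (MpPsi.toRep (schrodingerSB (dotProductBilin F F) ψ hl hb₂) (s' nn) f) = cst • φ₀ f :=
    fun nn hnn => exists_fibreZero_toRep_eq_smul hl hb₂ hb₀ φ₀ hφ₀ hψ (s' nn) (hYp nn hnn)
  -- (b) frame-diagonal elements are `Y`-stable
  have hYq : ∀ t : G, (∃ α : S, ((M t⁻¹ : GL n S) : Matrix n n S) *ᵥ x₀ = α • x₀) →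
      (∀ j, ∃ ν : S, ((M t⁻¹ : GL n S) : Matrix n n S) *ᵥ b j = ν • b j) →
      ∀ y₁ : Fin 2 → F, ∃ y₁' : Fin 2 → F, ((s' t).1.1).1 (0, Sum.elim y₁ 0) = (0, Sum.elim y₁' 0) := by
    intro t hα hν y₁
    obtain ⟨v, hv⟩ := hsurj (0, Sum.elim y₁ 0)
    rw [← hv, hact]
    obtain ⟨α, hα⟩ := hα
    exact exists_frameCoords_mulVec_eq_zero_inl Γv hΓ _ _ (hadj t) ha hα hν v hv
  -- (h₁): conjugation-quotients and commutators act trivially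
  obtain ⟨t, hα, hν, n₁, hn₁, n₂, hn₂, heq⟩ := hgen nn hnn
  obtain ⟨c0, hc0, hc0'⟩ := hscal nn hnn
  obtain ⟨c1, hc1, hc1'⟩ := hscal n₁ hn₁
  obtain ⟨c2, hc2, hc2'⟩ := hscal n₂ hn₂
  have hA := fibreZero_toRep_conj_mul_inv hl hb₂ φ₀ hφ₀ hψ (s' t) (hYq t hα hν) (s' nn) hc0 hc0'
  have hB := fibreZero_toRep_commutator hl hb₂ φ₀ (s' n₁) (s' n₂) hc1 hc2 hc1' hc2'
  rw [heq]
  simp only [map_mul, map_inv]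
  exact fibreZero_toRep_mul_eq hl hb₂ φ₀ _ _ hA hB f

include hq hΓ hsurj hact hadj in
/-- **(h₂) FROM THE FRAME ACTION**: the centre family of `hZ` (`M n⁻¹` fixes `x₀, bⱼ`, `M n⁻¹ y₀ = y₀ + μ x₀`, `σ μ = φ(t) δ`) acts through `s′` as the
Siegel unipotents `unipotentσ (t • c)` of the norm chirp (★ p831732 `frameCoords_mulVec_eq_unipotentσ`). [cite: MoeglinVignerasWaldspurger1987, Chap. 3 §IV.2]
[cite: Kudla1986, proof of Thm. 2.8] -/
theorem exists_coe_comp_eq_unipotentσ_of_frameAction (c : ((Fin 2 ⊕ Fin m) → F) →ₗ[F] ((Fin 2 ⊕ Fin m) → F))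
    (hc : ∀ x : (Fin 2 ⊕ Fin m) → F, c x = Sum.elim ![x (Sum.inl 0), -d * x (Sum.inl 1)] 0)
    (hZ : ∀ t : F, ∃ nn ∈ N, ((M nn⁻¹ : GL n S) : Matrix n n S) *ᵥ x₀ = x₀ ∧ (∀ j, ((M nn⁻¹ : GL n S) : Matrix n n S) *ᵥ b j = b j) ∧
      ∃ μ : S, ((M nn⁻¹ : GL n S) : Matrix n n S) *ᵥ y₀ = y₀ + μ • x₀ ∧ σ μ = φ t * δ) (t : F) :
    ∃ nn : N, (((s'.comp N.subtype) nn).1.1).1 = unipotentσ (t • c) := by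
  obtain ⟨nn, hnn, hx0, hb0, μ, hy0, hμ⟩ := hZ t
  refine ⟨⟨nn, hnn⟩, LinearEquiv.ext fun w => ?_⟩
  obtain ⟨v, rfl⟩ := hsurj w
  rw [MonoidHom.coe_comp, Function.comp_apply, Subgroup.coe_subtype, hact]
  exact frameCoords_mulVec_eq_unipotentσ hq Γv hΓ _ _ (hadj nn) hx0 hb0 hy0 hμ c hc v

include hq hΓ hsurj hact hadj hφ₀ hb₀ in
/-- **`Coinvariants.ker (ω′|_N) = ker φ₀` IN THE DOT MODEL** from the frame action (★ p831322 `coinvariantsKer_eq_ker_fibreZero` with (h₁), (h₂) above and the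
norm chirp of ★ p831536; `d` a non-square). [cite: Kudla1986, Thm. 2.8] [cite: MoeglinVignerasWaldspurger1987, Chap. 3 §IV.5] [cite: GelbartRogawski1991, §3.2 (3.2.3) p. 457] -/
theorem coinvariantsKer_eq_ker_of_frameAction (hψ : ψ.IsContinuousNontrivial) (hd : ∀ r : F, r * r ≠ d) (ha : ∀ j, a j ≠ 0)
    (hN : ∀ nn ∈ N, ((M nn⁻¹ : GL n S) : Matrix n n S) *ᵥ x₀ = x₀ ∧
      ∀ j, ∃ μ : S, ((M nn⁻¹ : GL n S) : Matrix n n S) *ᵥ b j = b j + μ • x₀)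
    (hgen : ∀ nn ∈ N, ∃ t : G, (∃ α : S, ((M t⁻¹ : GL n S) : Matrix n n S) *ᵥ x₀ = α • x₀) ∧
      (∀ j, ∃ ν : S, ((M t⁻¹ : GL n S) : Matrix n n S) *ᵥ b j = ν • b j) ∧
      ∃ n₁ ∈ N, ∃ n₂ ∈ N, nn = t * nn * t⁻¹ * nn⁻¹ * (n₁ * n₂ * n₁⁻¹ * n₂⁻¹))
    (hZ : ∀ t : F, ∃ nn ∈ N, ((M nn⁻¹ : GL n S) : Matrix n n S) *ᵥ x₀ = x₀ ∧ (∀ j, ((M nn⁻¹ : GL n S) : Matrix n n S) *ᵥ b j = b j) ∧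
      ∃ μ : S, ((M nn⁻¹ : GL n S) : Matrix n n S) *ᵥ y₀ = y₀ + μ • x₀ ∧ σ μ = φ t * δ) :
    Representation.Coinvariants.ker
        ((MpPsi.toRep (schrodingerSB (dotProductBilin F F (m := Fin 2 ⊕ Fin m)) ψ hl hb₂)).comp (s'.comp N.subtype)) = LinearMap.ker φ₀ := by
  obtain ⟨c, hc⟩ := exists_linearMap_lineBlock (R := F) (m := m) d
  have h₁' : ∀ (nn : N) (f : SchwartzBruhat ((Fin 2 ⊕ Fin m) → F)),
      φ₀ (MpPsi.toRep (schrodingerSB (dotProductBilin F F) ψ hl hb₂) ((s'.comp N.subtype) nn) f) = φ₀ f :=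
    fun nn f => fibreZero_toRep_eq_of_frameAction hl hb₂ hb₀ φ₀ hφ₀ Γv hΓ hsurj s' M hact hadj N hψ ha hN hgen nn.2 f
  have h₂' := exists_toRep_comp_eq_unipOpPi hl hb₂ φ₀ hφ₀ c hψ (dotProductBilin_lineBlock_symm c hc)
    (fun x hx => halfForm_lineBlock_eq_zero c hc x hx) (s'.comp N.subtype) h₁'
    (exists_coe_comp_eq_unipotentσ_of_frameAction hl hb₂ hq Γv hΓ hsurj s' M hact hadj N c hc hZ)
  exact coinvariantsKer_eq_ker_fibreZero hl φ₀ hφ₀ _ c hψ (fun x hx0 => inl_eq_zero_of_halfForm_lineBlock_eq_zero hd c hc x hx0) h₁' h₂'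

end Mechanism

/-! ## §3 The assembler -/

section Assembly

variable {F : Type*} [Field F] [ValuativeRel F] [TopologicalSpace F] [IsNonarchimedeanLocalField F] [Invertible (2 : F)]
  {ψ : AddChar F Circle} (hl : IsLocallyConstant (⇑ψ : F → Circle))
  {S : Type*} [CommRing S] {φ : F →+* S} {Ψq : (F × F) ≃+ S} {δ : S} {d : F} (hq : IsQuadraticCoordinates φ Ψq δ d)
  {σ : S →+* S} {n : Type*} [Fintype n] [DecidableEq n] {T : Matrix n n F}
  (hb₁ : ∀ y : n → F, Continuous fun u : n → F => Matrix.toLinearMap₂' F T u y)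
  {m : ℕ} {x₀ y₀ : n → S} {b : Fin m → n → S} {a : Fin m → F}
  {G : Type*} [Group G] (s : G →* MpPsi (schrodingerSB (Matrix.toLinearMap₂' F T) ψ hl hb₁)) (M : G →* GL n S) (N : Subgroup G)

include hq in
/-- **THE ABSTRACT ASSEMBLER — `Coinvariants.ker (ω|_N) = Ψ⁻¹(ker φ₀)`.**  See the module docstring for the reading of every binder.
[cite: Kudla1986, Thm. 2.8] [cite: MoeglinVignerasWaldspurger1987, Chap. 3 §IV.2, §IV.5] [cite: GelbartRogawski1991, §3.2 (3.2.3) p. 457] -/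
theorem coinvariantsKer_comp_eq_comap_of_frame (hψ : ψ.IsContinuousNontrivial) (hd : ∀ r : F, r * r ≠ d)
    (hσφ : ∀ x, σ (φ x) = φ x) (hσδ : σ δ = -δ) (hσσ : ∀ z, σ (σ z) = z) (hT : T.IsSymm) (hTd : IsUnit T.det)
    (hx : hermForm σ (T.map φ) x₀ x₀ = 0) (hy : hermForm σ (T.map φ) y₀ y₀ = 0) (hxy : hermForm σ (T.map φ) x₀ y₀ = 1)
    (hxb : ∀ j, hermForm σ (T.map φ) x₀ (b j) = 0) (hyb : ∀ j, hermForm σ (T.map φ) y₀ (b j) = 0)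
    (hbb : ∀ j j', j ≠ j' → hermForm σ (T.map φ) (b j) (b j') = 0) (hba : ∀ j, hermForm σ (T.map φ) (b j) (b j) = φ (a j))
    (ha : ∀ j, a j ≠ 0)
    (hexp : ∀ v : n → S, v = hermForm σ (T.map φ) y₀ v • x₀ + hermForm σ (T.map φ) x₀ v • y₀ +
      ∑ j, (φ (a j)⁻¹ * hermForm σ (T.map φ) (b j) v) • b j)
    (hM : ∀ g, M g ∈ unitaryGroupOfForm σ (T.map φ))
    (hι : ∀ (g : G) (x : n → S), ((s g).1.1).1 (reIm Ψq n x) = reIm Ψq n ((M g : Matrix n n S) *ᵥ x))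
    (hN : ∀ nn ∈ N, ((M nn⁻¹ : GL n S) : Matrix n n S) *ᵥ x₀ = x₀ ∧
      ∀ j, ∃ μ : S, ((M nn⁻¹ : GL n S) : Matrix n n S) *ᵥ b j = b j + μ • x₀)
    (hgen : ∀ nn ∈ N, ∃ t : G, (∃ α : S, ((M t⁻¹ : GL n S) : Matrix n n S) *ᵥ x₀ = α • x₀) ∧
      (∀ j, ∃ ν : S, ((M t⁻¹ : GL n S) : Matrix n n S) *ᵥ b j = ν • b j) ∧
      ∃ n₁ ∈ N, ∃ n₂ ∈ N, nn = t * nn * t⁻¹ * nn⁻¹ * (n₁ * n₂ * n₁⁻¹ * n₂⁻¹))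
    (hZ : ∀ t : F, ∃ nn ∈ N, ((M nn⁻¹ : GL n S) : Matrix n n S) *ᵥ x₀ = x₀ ∧ (∀ j, ((M nn⁻¹ : GL n S) : Matrix n n S) *ᵥ b j = b j) ∧
      ∃ μ : S, ((M nn⁻¹ : GL n S) : Matrix n n S) *ᵥ y₀ = y₀ + μ • x₀ ∧ σ μ = φ t * δ) :
    ∃ (Ψ : SchwartzBruhat (n → F) ≃ₗ[ℂ] SchwartzBruhat ((Fin 2 ⊕ Fin m) → F))
      (φ₀ : SchwartzBruhat ((Fin 2 ⊕ Fin m) → F) →ₗ[ℂ] SchwartzBruhat (Fin m → F)),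
      (∀ (f : SchwartzBruhat ((Fin 2 ⊕ Fin m) → F)) (u₀ : Fin m → F),
        (φ₀ f : (Fin m → F) → ℂ) u₀ = (f : ((Fin 2 ⊕ Fin m) → F) → ℂ) (Sum.elim 0 u₀)) ∧
      Representation.Coinvariants.ker (((MpPsi.toRep (schrodingerSB (Matrix.toLinearMap₂' F T) ψ hl hb₁)).comp s).comp N.subtype) =
        (LinearMap.ker φ₀).comap (Ψ : SchwartzBruhat (n → F) →ₗ[ℂ] SchwartzBruhat ((Fin 2 ⊕ Fin m) → F)) := by
  classical
  -- the dot model on `F^{Fin 2 ⊔ Fin m}` and the fibre model on `F^{Fin m}`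
  have hb₂ : ∀ y : (Fin 2 ⊕ Fin m) → F, Continuous fun u : (Fin 2 ⊕ Fin m) → F => dotProductBilin F F u y :=
    fun y => continuous_dotProductBilin_left y
  have hb₀ : ∀ y₀ : Fin m → F, Continuous fun u₀ : Fin m → F => dotProductBilin F F u₀ y₀ := fun y => continuous_dotProductBilin_left y
  -- the frame chart
  obtain ⟨Γ, hΓ₁, -, hΓ₃⟩ := exists_frameChart hq hT hσφ hσδ hσσ hx hy hxy hxb hyb hbb hba ha hexp
  obtain ⟨Γv, hΓv⟩ : ∃ Γv : (n → S) → ((Fin 2 ⊕ Fin m) → F) × ((Fin 2 ⊕ Fin m) → F), Γv = fun v => Γ (reIm Ψq n v) := ⟨_, rfl⟩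
  have hΓ : ∀ v : n → S, Γv v =
      (Sum.elim ![re Ψq (hermForm σ (T.map φ) x₀ v), im Ψq (hermForm σ (T.map φ) x₀ v)]
          (fun j => (a j)⁻¹ * re Ψq (hermForm σ (T.map φ) (b j) v)),
        Sum.elim ![im Ψq (hermForm σ (T.map φ) y₀ v), -re Ψq (hermForm σ (T.map φ) y₀ v)]
          (fun j => im Ψq (hermForm σ (T.map φ) (b j) v))) := fun v => by rw [hΓv]; exact hΓ₁ v
  have hsurj : ∀ w : ((Fin 2 ⊕ Fin m) → F) × ((Fin 2 ⊕ Fin m) → F), ∃ v : n → S, Γv v = w := fun w =>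
    ⟨(reIm Ψq n).symm (Γ.symm w), by rw [hΓv]; dsimp only; rw [AddEquiv.apply_symm_apply, LinearEquiv.apply_symm_apply]⟩
  -- the Heisenberg isomorphism, the intertwiner, the transported splitting
  have halt := sub_eq_sub_of_alt_eq Γ hΓ₃
  obtain ⟨Ψ, hΨ, -⟩ := exists_intertwiner_implements_conj T hTd hl hb₁ hb₂ Γ hΓ₃ hψ
    (Heisenberg.conjCoboundaryEquiv Γ halt) (fun _ _ => rfl)
  have hφ := Heisenberg.conjCoboundaryEquiv_ofSymplectic_act Γ halt
  obtain ⟨s', hs'⟩ : ∃ s' : G →* MpPsi (schrodingerSB (dotProductBilin F F (m := Fin 2 ⊕ Fin m)) ψ hl hb₂), s' =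
      (MpPsi.congr (schrodingerSB (Matrix.toLinearMap₂' F T) ψ hl hb₁) (schrodingerSB (dotProductBilin F F (m := Fin 2 ⊕ Fin m)) ψ hl hb₂)
        (Φ := Heisenberg.conjCoboundaryEquiv Γ halt) (T := Ψ) (φ := symplecticConjOfAlt Γ halt) hΨ hφ).toMonoidHom.comp s := ⟨_, rfl⟩
  -- the symplectic component of `s′ g` is `Γ (s g) Γ⁻¹`, so it acts through `Γv` by the matrix `M g`
  have hs'1 : ∀ g : G, (s' g).1.1 = symplecticConjOfAlt Γ halt (s g).1.1 := fun g => by rw [hs']; rfl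
  have hact : ∀ (g : G) (v : n → S), ((s' g).1.1).1 (Γv v) = Γv ((M g : Matrix n n S) *ᵥ v) := by
    intro g v
    rw [hs'1, hΓv]
    dsimp only
    rw [symplecticConjOfAlt_apply, LinearEquiv.symm_apply_apply, hι]
  have hadj : ∀ (g : G) (x v : n → S),
      hermForm σ (T.map φ) x ((M g : Matrix n n S) *ᵥ v) = hermForm σ (T.map φ) (((M g⁻¹ : GL n S) : Matrix n n S) *ᵥ x) v := by
    intro g x v
    rw [map_inv]
    exact hermForm_mulVec_eq_of_mem σ (T.map φ) (hM g) x v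
  -- the fibre over `0`; the dot-model identity; transport back along `Ψ`
  obtain ⟨φ₀, hφ₀⟩ := exists_fibreMap (F := F) (ι₁ := Fin 2) (ι₀ := Fin m) (0 : Fin 2 → F)
  have key := coinvariantsKer_eq_ker_of_frameAction hl hb₂ hb₀ φ₀ hφ₀ hq Γv hΓ hsurj s' M hact hadj N hψ hd ha hN hgen hZ
  refine ⟨Ψ, φ₀, hφ₀, ?_⟩
  rw [← key]
  refine coinvariantsKer_eq_comap_of_intertwiner _ _ Ψ fun nn f => ?_
  have h := (MpPsi.toRep_congr_comp_apply _ _ hΨ hφ s (nn : G) f).symm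
  rw [← hs'] at h
  exact h

include hq in
/-- **`r_N(ω) ≃ 𝒮(F^{Fin m})`** — the `N`-coinvariants of the Weil representation `ω = toRep ∘ s` are the Schwartz–Bruhat space of the `Fin m` coordinates
(`= H(Y^⊥ ∕ Y)`'s Schrödinger model, ★ p830834), under the hypotheses of `coinvariantsKer_comp_eq_comap_of_frame`; for `m = 1` (U(2,1) at a non-split place)
this is B-p18's «`r_{N(ℓ)}(ω) = S_Y ≅ 𝒮(F_v)`» = [GelbartRogawski1991 (3.2.3)]'s `Φ ↦ Φ(0) ∈ ℱ`. [cite: Kudla1986, Thm. 2.8] [cite: MoeglinVignerasWaldspurger1987, Chap. 3 §IV.5]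
[cite: GelbartRogawski1991, §3.2 (3.2.3) p. 457] -/
theorem exists_coinvariants_equiv_of_frame (hψ : ψ.IsContinuousNontrivial) (hd : ∀ r : F, r * r ≠ d)
    (hσφ : ∀ x, σ (φ x) = φ x) (hσδ : σ δ = -δ) (hσσ : ∀ z, σ (σ z) = z) (hT : T.IsSymm) (hTd : IsUnit T.det)
    (hx : hermForm σ (T.map φ) x₀ x₀ = 0) (hy : hermForm σ (T.map φ) y₀ y₀ = 0) (hxy : hermForm σ (T.map φ) x₀ y₀ = 1)
    (hxb : ∀ j, hermForm σ (T.map φ) x₀ (b j) = 0) (hyb : ∀ j, hermForm σ (T.map φ) y₀ (b j) = 0)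
    (hbb : ∀ j j', j ≠ j' → hermForm σ (T.map φ) (b j) (b j') = 0) (hba : ∀ j, hermForm σ (T.map φ) (b j) (b j) = φ (a j))
    (ha : ∀ j, a j ≠ 0)
    (hexp : ∀ v : n → S, v = hermForm σ (T.map φ) y₀ v • x₀ + hermForm σ (T.map φ) x₀ v • y₀ +
      ∑ j, (φ (a j)⁻¹ * hermForm σ (T.map φ) (b j) v) • b j)
    (hM : ∀ g, M g ∈ unitaryGroupOfForm σ (T.map φ))
    (hι : ∀ (g : G) (x : n → S), ((s g).1.1).1 (reIm Ψq n x) = reIm Ψq n ((M g : Matrix n n S) *ᵥ x))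
    (hN : ∀ nn ∈ N, ((M nn⁻¹ : GL n S) : Matrix n n S) *ᵥ x₀ = x₀ ∧
      ∀ j, ∃ μ : S, ((M nn⁻¹ : GL n S) : Matrix n n S) *ᵥ b j = b j + μ • x₀)
    (hgen : ∀ nn ∈ N, ∃ t : G, (∃ α : S, ((M t⁻¹ : GL n S) : Matrix n n S) *ᵥ x₀ = α • x₀) ∧
      (∀ j, ∃ ν : S, ((M t⁻¹ : GL n S) : Matrix n n S) *ᵥ b j = ν • b j) ∧
      ∃ n₁ ∈ N, ∃ n₂ ∈ N, nn = t * nn * t⁻¹ * nn⁻¹ * (n₁ * n₂ * n₁⁻¹ * n₂⁻¹))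
    (hZ : ∀ t : F, ∃ nn ∈ N, ((M nn⁻¹ : GL n S) : Matrix n n S) *ᵥ x₀ = x₀ ∧ (∀ j, ((M nn⁻¹ : GL n S) : Matrix n n S) *ᵥ b j = b j) ∧
      ∃ μ : S, ((M nn⁻¹ : GL n S) : Matrix n n S) *ᵥ y₀ = y₀ + μ • x₀ ∧ σ μ = φ t * δ) :
    Nonempty (Representation.Coinvariants (((MpPsi.toRep (schrodingerSB (Matrix.toLinearMap₂' F T) ψ hl hb₁)).comp s).comp N.subtype) ≃ₗ[ℂ]
      SchwartzBruhat (Fin m → F)) := by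
  obtain ⟨Ψ, φ₀, hφ₀, hker⟩ := coinvariantsKer_comp_eq_comap_of_frame hl hq hb₁ s M N hψ hd hσφ hσδ hσσ hT hTd hx hy hxy hxb hyb hbb hba ha hexp
    hM hι hN hgen hZ
  have hk : Representation.Coinvariants.ker (((MpPsi.toRep (schrodingerSB (Matrix.toLinearMap₂' F T) ψ hl hb₁)).comp s).comp N.subtype) =
      LinearMap.ker (φ₀ ∘ₗ (Ψ : SchwartzBruhat (n → F) →ₗ[ℂ] SchwartzBruhat ((Fin 2 ⊕ Fin m) → F))) := by
    rw [hker, LinearMap.ker_comp]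
  exact ⟨(Submodule.quotEquivOfEq _ _ hk).trans
    (LinearMap.quotKerEquivOfSurjective _ ((fibreZero_surjective φ₀ hφ₀).comp Ψ.surjective))⟩

end Assembly

end Summit.HodgeConjecture.HodgeConjecture.Cruxes.H413.F0P2oYCoinvariantsOfFrameAssembly

end
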